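import Literature.NumberTheory.EllipticCurves.ComplexMultiplicationNotSemistable
import HarnessLib

/-!
# PARTITION lemma, good-supersingular row: the cells X5 / X8 / X6 / X7 exhaust `ss(p)`

HONEST FRAMING (cell `b2b-bsdres`, run/shared/lean/b2b/bsd-rank1-residual/): prove what is
provable now; shrink each hard class to its core with data; no claim beyond stated classes.  This
file is CELL SCAFFOLDING for the PARTITION lemma (human GO 2026-08-19T21:53Z "are we sure the
classes fully partition the space?"; owner of `Partition.lean`: the hyp seat; this row: harvest
seat 1, RECLASSIFY §GEN-8.2 / §GEN-9): our own bookkeeping theorems about the class PREDICATES of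
`Literature/NumberTheory/EllipticCurves/Rank1Residual/Predicates.lean`, not literature.

* `classX5_or_classX8_or_classX6_or_classX7_of_goodSS` — at a good supersingular prime `p` the
  pair `(E, p)` satisfies one of the four supersingular class predicates, read in the census
  priority order `p = 2 → X5`; `p = 3 ∧ a₃ ≠ 0 → X8`; `sst → X6` (then `5 ≤ p ∨ a₃ = 0` holds);
  `¬sst → X7`.
* disjointness at the predicate level: `ClassX6 → ¬ClassX7`, `ClassX6 → ¬ClassX8`; the overlap
  `ClassX7 ∩ ClassX8` (non-semistable `p = 3`, `a₃ = ±3` pairs, which the census counts in X8) is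
  recorded as `classX7_of_classX8_of_not_semistable`, so a classification function must test X8
  before X7;
* CM: `ClassX6 → ¬cm` and `cm ∧ ss(p) → ClassX7` are the tree theorems
  `Rank1Residual.ClassX6.not_hasCM`, `Rank1Residual.classX7_of_hasCM_of_goodSS`
  (`ComplexMultiplicationNotSemistable.lean`: a CM curve over `ℚ` is never semistable — Tate–Ogg
  + Silverman *ATAEC* II.6.4), re-exported here as `goodSS_cm_row`: at a good supersingular prime a
  CM pair lies in the X7 predicate and in no other supersingular class predicate except possibly
  X5 (`p = 2`) — so `cellOf` must decide `HasCM` BEFORE the X7 test (referee acceptance test R85.4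
  point 7).
-/

noncomputable section

open scoped Classical

open Literature.NumberTheory.EllipticCurves.Rank1Residual

namespace Summit.BirchSwinnertonDyer.Rank1Residual

variable (W : WeierstrassCurve ℚ) (p : ℕ) [Fact p.Prime] [W.IsGloballyMinimal]

/-- A prime other than `2` and `3` is at least `5`. -/
theorem five_le_of_prime_of_ne (hp2 : p ≠ 2) (hp3 : p ≠ 3) : 5 ≤ p := by
  have h2 := (Fact.out : p.Prime).two_le
  have h4 : p ≠ 4 := by rintro rfl; exact absurd (Fact.out : (4 : ℕ).Prime) (by decide)
  omega

/-- **The good-supersingular row is exhausted by X5 ∪ X8 ∪ X6 ∪ X7** (census priority order). -/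
theorem classX5_or_classX8_or_classX6_or_classX7_of_goodSS (h : GoodSS W p) :
    ClassX5 W p ∨ ClassX8 W p ∨ ClassX6 W p ∨ ClassX7 W p := by
  by_cases hp2 : p = 2
  · exact Or.inl hp2
  by_cases h8 : p = 3 ∧ W.frobeniusTrace 3 ≠ 0
  · obtain ⟨rfl, ha⟩ := h8
    exact Or.inr (Or.inl ⟨rfl, h, ha⟩)
  have h6 : 5 ≤ p ∨ W.frobeniusTrace 3 = 0 := by
    by_cases hp3 : p = 3
    · right; by_contra hne; exact h8 ⟨hp3, hne⟩
    · left; exact five_le_of_prime_of_ne p hp2 hp3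
  by_cases hs : Semistable W
  · exact Or.inr (Or.inr (Or.inl ⟨h, hs, h6⟩))
  · exact Or.inr (Or.inr (Or.inr ⟨h, hs⟩))

/-- X6 and X7 are disjoint at the predicate level (`sst` versus `¬sst`). -/
theorem not_classX7_of_classX6 (h : ClassX6 W p) : ¬ ClassX7 W p := fun h7 ↦ h7.2 h.2.1

/-- X6 and X8 are disjoint at the predicate level (X6 at `p = 3` forces `a₃ = 0`). -/
theorem not_classX8_of_classX6 (h : ClassX6 W p) : ¬ ClassX8 W p := by
  rintro ⟨rfl, -, ha⟩
  rcases h.2.2 with h5 | h0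
  · omega
  · exact ha h0

/-- The X7 predicate CONTAINS the non-semistable X8 pairs (`p = 3`, `a₃ = ±3`, `¬sst`): test X8
before X7 in any classification function. -/
theorem classX7_of_classX8_of_not_semistable (h : ClassX8 W p) (hs : ¬ Semistable W) :
    ClassX7 W p := by
  obtain ⟨rfl, hss, -⟩ := h
  exact ⟨hss, hs⟩

/-- **CM on the good-supersingular row**: a CM pair at a good supersingular prime satisfies the
X7 predicate and not the X6 predicate (tree theorems `classX7_of_hasCM_of_goodSS`,
`ClassX6.not_hasCM`: a CM curve over `ℚ` is never semistable).  Not claimed here: `cm ∧ ss(3) ⇒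
a₃ = 0` (i.e. CM pairs avoid X8), which would need "good CM reduction at an inert prime is
supersingular with `a_p = 0`" as a tree theorem.  Consequence for `cellOf`: decide `HasCM`
before the X7 test. -/
theorem goodSS_cm_row [W.IsElliptic] (hCM : W.HasCM) (h : GoodSS W p) :
    ClassX7 W p ∧ ¬ ClassX6 W p :=
  ⟨classX7_of_hasCM_of_goodSS W hCM h, fun h6 ↦ ClassX6.not_hasCM W h6 hCM⟩

end Summit.BirchSwinnertonDyer.Rank1Residual

end
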